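import Literature.Computability.Complexity.RandomizedModularZeroTest
import Literature.Computability.Complexity.ProbabilisticClassesProofs
import HarnessLib

/-!
# Schwartz–Zippel on coin blocks over an arbitrary integral domain (e.g. `𝔽_p`), for points
# indexed by `Fin V` or by matrix positions `Fin n × Fin n`

`RandomizedModularZeroTest.lean` transports Mathlib's `MvPolynomial.schwartz_zippel_totalDegree`
to coin strings for INTEGER polynomials: a uniform string of `V` blocks of `k` bits, read as the point
`i ↦ ⟦block i⟧ ∈ [0, 2^k) ⊆ ℤ`, is a zero of a nonzero `Q ∈ ℤ[x_0, …, x_{V-1}]` with probability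
`≤ deg Q / 2^k` (`ModularZeroTest.uniformProb_eval_ptOf_eq_zero_le`). The verifiers that work MODULO
A PRIME `p` (Bläser–Ikenmeyer–Jindal–Lysikov 2018, Thms. 4–6: guessed circuits over `𝔽_p` checked by
random evaluation) need the same statement over the FIELD `𝔽_p`, the block values being read through
the cast `ℕ → 𝔽_p`, which is injective on `[0, 2^k)` as soon as `2^k ≤ p`. This file proves it once
for every commutative domain `F` and every reading `ι : ℕ → F` injective on `[0, 2^k)`:

* `ModularZeroTest.blockPt ι k V z : Fin V → F` — the point read off the blocks;
* **`uniformProb_eval_blockPt_eq_zero_le`** — `Pr_z[Q(blockPt z) = 0] ≤ deg Q / 2^k` for `Q ≠ 0`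
  (strings of exactly `V·k` bits), and `uniformProb_eval_blockPt_eq_zero_le_of_le` for longer coin
  strings (the event only reads the first `V·k` coins; product rule `cnt_take_drop`);
* the matrix-indexed form **`uniformProb_eval_matrixPt_eq_zero_le`** for
  `Q ∈ F[x_{ab} : a, b < n]` and the row-major reading `(a, b) ↦ ⟦block (a·n + b)⟧`
  (`ModularZeroTest.matrixPt`), via `finProdFinEquiv`;
* the instance `ZMod p`: `natCast_injOn_of_two_pow_le` (`2^k ≤ p`).

## References

* J. T. Schwartz, *Fast probabilistic algorithms for verification of polynomial identities*,
  J. ACM 27 (1980), Lemma 1 / Cor. 1 [Schwartz1980].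
* S. Arora, B. Barak, *Computational Complexity: A Modern Approach*, CUP 2009, Lemma 7.5 / A.36
  (Schwartz–Zippel over a field, random point of `S^m`) [AroraBarakCC2009].
* M. Bläser, C. Ikenmeyer, G. Jindal, V. Lysikov, STOC 2018 = ECCC TR18-064, §6 (random evaluation
  over `𝔽_p` in the proofs of Thms. 4–6) [BlaserIkenmeyerJindalLysikov2018].
-/

noncomputable section

namespace Literature.Computability.Complexity

open _root_.Computability Polynomial Finset

namespace ModularZeroTest

/-! ### Blocks (public twins of the private block lemmas of `RandomizedModularZeroTest.lean`) -/

/-- Block `0` is the prefix. [folklore] -/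
private theorem blockOf_zero' (k : ℕ) (z : List Bool) : blockOf k 0 z = z.take k := by simp [blockOf]

/-- Block `i + 1` of `z` is block `i` of `z.drop k`. [folklore] -/
private theorem blockOf_succ' (k i : ℕ) (z : List Bool) : blockOf k (i + 1) z = blockOf k i (z.drop k) := by
  simp only [blockOf, List.drop_drop]
  congr 2
  ring

/-- A block has length at most `k`. [cite: AroraBarakCC2009, Lemma 7.5 (random evaluation point)] -/
theorem length_blockOf_le (k i : ℕ) (z : List Bool) : (blockOf k i z).length ≤ k := by
  simp [blockOf, List.length_take]

/-- Inside a string of at least `V` blocks every block `i < V` has length exactly `k`.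
[cite: AroraBarakCC2009, Lemma 7.5 (random evaluation point)] -/
theorem length_blockOf_of_le {k V i : ℕ} {z : List Bool} (hz : V * k ≤ z.length) (hi : i < V) :
    (blockOf k i z).length = k := by
  simp only [blockOf, List.length_take, List.length_drop]
  have : (i + 1) * k ≤ V * k := Nat.mul_le_mul_right k hi
  rw [Nat.succ_mul] at this
  omega

/-- The value of a block is `< 2^k`. [cite: AroraBarakCC2009, Lemma 7.5 (random evaluation point)] -/
theorem bitsToNat_blockOf_lt (k i : ℕ) (z : List Bool) : bitsToNat (blockOf k i z) < 2 ^ k :=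
  (bitsToNat_lt _).trans_le (Nat.pow_le_pow_right (by norm_num) (length_blockOf_le k i z))

/-- **Blocks `i < V` only read the first `V·k` symbols.** [cite: AroraBarakCC2009, Lemma 7.5 (random evaluation point)] -/
theorem blockOf_take {k V i : ℕ} (hi : i < V) (z : List Bool) : blockOf k i (z.take (V * k)) = blockOf k i z := by
  simp only [blockOf, List.drop_take, List.take_take]
  congr 1
  have : (i + 1) * k ≤ V * k := Nat.mul_le_mul_right k hi
  rw [Nat.succ_mul] at this
  omega

/-- A string of `V` blocks is determined by its blocks. [folklore] -/
private theorem eq_of_blockOf_eq' {k : ℕ} : ∀ {V : ℕ} {z z' : List Bool}, z.length = V * k → z'.length = V * k →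
    (∀ i < V, blockOf k i z = blockOf k i z') → z = z'
  | 0, z, z', hz, hz', _ => by
    rw [Nat.zero_mul, List.length_eq_zero_iff] at hz hz'
    rw [hz, hz']
  | V + 1, z, z', hz, hz', h => by
    have h0 := h 0 (Nat.succ_pos V)
    rw [blockOf_zero', blockOf_zero'] at h0
    have hrest : z.drop k = z'.drop k :=
      eq_of_blockOf_eq' (k := k) (V := V) (by rw [List.length_drop, hz, Nat.succ_mul]; omega)
        (by rw [List.length_drop, hz', Nat.succ_mul]; omega)
        fun i hi => by rw [← blockOf_succ', ← blockOf_succ']; exact h (i + 1) (by omega)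
    rw [← List.take_append_drop k z, ← List.take_append_drop k z', h0, hrest]

/-! ### The point read through `ι` -/

variable {F : Type*}

/-- **The point read off the blocks through `ι : ℕ → F`**: coordinate `i < V` is `ι ⟦block i⟧`
(`ι = Nat.cast` into `𝔽_p` for the verifiers working modulo `p`).
[cite: BlaserIkenmeyerJindalLysikov2018, §6 (random evaluation over `𝔽_p`)] [cite: AroraBarakCC2009, Lemma 7.5] -/
def blockPt (ι : ℕ → F) (k V : ℕ) (z : List Bool) : Fin V → F := fun i => ι (bitsToNat (blockOf k i z))

/-- **The matrix point read off the blocks** (row-major: entry `(a, b)` is block `a·n + b`).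
[cite: BlaserIkenmeyerJindalLysikov2018, §6 (random evaluation over `𝔽_p`)] [cite: AroraBarakCC2009, Lemma 7.5] -/
def matrixPt (ι : ℕ → F) (k n : ℕ) (z : List Bool) : Fin n × Fin n → F :=
  fun ab => ι (bitsToNat (blockOf k (ab.1.val * n + ab.2.val) z))

/-- `blockPt` only reads the first `V·k` symbols. [cite: AroraBarakCC2009, Lemma 7.5] -/
theorem blockPt_take (ι : ℕ → F) (k V : ℕ) (z : List Bool) : blockPt ι k V (z.take (V * k)) = blockPt ι k V z := by
  funext i
  simp [blockPt, blockOf_take i.isLt]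

/-- The sample set `ι [0, 2^k) ⊆ F`. [folklore] -/
private def sampleSetF (ι : ℕ → F) (k : ℕ) [DecidableEq F] : Finset F := (range (2 ^ k)).image ι

/-- `#ι[0, 2^k) = 2^k` for `ι` injective there. [folklore] -/
private theorem card_sampleSetF [DecidableEq F] {ι : ℕ → F} {k : ℕ} (hι : Set.InjOn ι (Set.Iio (2 ^ k))) :
    (sampleSetF ι k).card = 2 ^ k := by
  rw [sampleSetF, card_image_of_injOn (fun a ha b hb h => hι (by simpa using ha) (by simpa using hb) h),
    card_range]

/-- **The strings with a given property of their point are at most as many as the points of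
`(ι[0,2^k))^V` with that property** (blocks determine the string; `ι` injective on block values). [folklore] -/
private theorem cnt_blockPt_le [DecidableEq F] {ι : ℕ → F} (k V : ℕ) (hι : Set.InjOn ι (Set.Iio (2 ^ k)))
    (P : (Fin V → F) → Prop) [DecidablePred P] :
    cnt (V * k) {z | P (blockPt ι k V z)} ≤ ((Fintype.piFinset fun _ : Fin V => sampleSetF ι k).filter P).card := by
  classical
  unfold cnt
  refine card_le_card_of_injOn (fun r : List.Vector Bool (V * k) => blockPt ι k V r.toList)
    (fun r hr => ?_) (fun r hr r' hr' h => ?_)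
  · simp only [coe_filter, mem_univ, true_and, Set.mem_setOf_eq] at hr
    simp only [coe_filter, Fintype.mem_piFinset, Set.mem_setOf_eq]
    refine ⟨fun i => ?_, hr⟩
    rw [sampleSetF, mem_image]
    exact ⟨bitsToNat (blockOf k i r.toList), mem_range.2 (bitsToNat_blockOf_lt _ _ _), rfl⟩
  · apply List.Vector.toList_injective
    refine eq_of_blockOf_eq' (V := V) (k := k) (by simp) (by simp) fun i hi => ?_
    have hi' := congrFun h ⟨i, hi⟩
    simp only [blockPt] at hi'
    have hv := hι (bitsToNat_blockOf_lt k i r.toList) (bitsToNat_blockOf_lt k i r'.toList) hi'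
    exact bitsToNat_injOn_length k (length_blockOf_of_le (by simp) hi) (length_blockOf_of_le (by simp) hi) hv

/-- **Schwartz–Zippel on the coins, over a domain `F`**: for a nonzero `Q ∈ F[x_0, …, x_{V-1}]` and a
reading `ι : ℕ → F` injective on `[0, 2^k)`, the point read off a uniform string of `V` blocks of `k`
bits is a zero of `Q` with probability `≤ deg Q / 2^k`. [cite: AroraBarakCC2009, Lemma 7.5 (Schwartz–Zippel)]
[cite: Schwartz1980, Lemma 1] -/
theorem uniformProb_eval_blockPt_eq_zero_le [CommRing F] [IsDomain F] {ι : ℕ → F} {V k : ℕ}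
    (hι : Set.InjOn ι (Set.Iio (2 ^ k))) {Q : MvPolynomial (Fin V) F} (hQ : Q ≠ 0) :
    uniformProb (V * k) {z | MvPolynomial.eval (blockPt ι k V z) Q = 0} ≤ (Q.totalDegree : ℝ) / 2 ^ k := by
  classical
  have hSZ := MvPolynomial.schwartz_zippel_totalDegree hQ (sampleSetF ι k)
  rw [card_sampleSetF hι] at hSZ
  have hS : (0 : ℚ≥0) < (2 ^ k : ℕ) := by exact_mod_cast Nat.two_pow_pos k
  have hSV : (0 : ℚ≥0) < ((2 ^ k : ℕ) : ℚ≥0) ^ V := pow_pos hS V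
  rw [div_le_div_iff₀ hSV hS] at hSZ
  have hnat : ((Fintype.piFinset fun _ : Fin V => sampleSetF ι k).filter
      fun f => MvPolynomial.eval f Q = 0).card * 2 ^ k ≤ Q.totalDegree * (2 ^ k) ^ V := by
    exact_mod_cast hSZ
  have hcnt := cnt_blockPt_le k V hι (fun f => MvPolynomial.eval f Q = 0)
  rw [uniformProb_eq_cnt_div, div_le_div_iff₀ (by positivity) (by positivity)]
  have h1 : (cnt (V * k) {z | MvPolynomial.eval (blockPt ι k V z) Q = 0} : ℝ) * 2 ^ k ≤
      (Q.totalDegree : ℝ) * (2 ^ k) ^ V := by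
    exact_mod_cast (Nat.mul_le_mul_right (2 ^ k) hcnt).trans hnat
  calc (cnt (V * k) {z | MvPolynomial.eval (blockPt ι k V z) Q = 0} : ℝ) * 2 ^ k
      ≤ (Q.totalDegree : ℝ) * (2 ^ k) ^ V := h1
    _ = (Q.totalDegree : ℝ) * 2 ^ (V * k) := by rw [← pow_mul, mul_comm k V]

/-- **The same for longer coin strings** (`V·k ≤ N`): the event reads only the first `V·k` coins, so
its probability under `N` uniform coins is its probability under `V·k` coins. [cite: AroraBarakCC2009, Lemma 7.5 (Schwartz–Zippel)] -/
theorem uniformProb_eval_blockPt_eq_zero_le_of_le [CommRing F] [IsDomain F] {ι : ℕ → F} {V k N : ℕ} (hN : V * k ≤ N)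
    (hι : Set.InjOn ι (Set.Iio (2 ^ k))) {Q : MvPolynomial (Fin V) F} (hQ : Q ≠ 0) :
    uniformProb N {z | MvPolynomial.eval (blockPt ι k V z) Q = 0} ≤ (Q.totalDegree : ℝ) / 2 ^ k := by
  obtain ⟨d, rfl⟩ := Nat.exists_eq_add_of_le hN
  have hset : cnt (V * k + d) {z | MvPolynomial.eval (blockPt ι k V z) Q = 0} =
      cnt (V * k + d) {z | z.take (V * k) ∈ {z | MvPolynomial.eval (blockPt ι k V z) Q = 0} ∧
        z.drop (V * k) ∈ (Set.univ : Set (List Bool))} :=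
    cnt_congr fun z _ => by simp [blockPt_take]
  have h2 : (0 : ℝ) < 2 ^ d := by positivity
  rw [uniformProb_eq_cnt_div, hset, cnt_take_drop, cnt_univ, pow_add, Nat.cast_mul]
  push_cast
  rw [mul_div_mul_right _ _ (ne_of_gt h2), ← uniformProb_eq_cnt_div]
  exact uniformProb_eval_blockPt_eq_zero_le hι hQ

/-! ### Matrix-indexed points -/

/-- The matrix point is the block point re-indexed by `finProdFinEquiv` (`(a, b) ↦ a·n + b`).
[cite: AroraBarakCC2009, Lemma 7.5] -/
theorem matrixPt_eq_blockPt_comp (ι : ℕ → F) (k n : ℕ) (z : List Bool) :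
    matrixPt ι k n z = blockPt ι k (n * n) z ∘ (finProdFinEquiv : Fin n × Fin n ≃ Fin (n * n)) := by
  funext ab
  simp only [matrixPt, blockPt, Function.comp_apply, finProdFinEquiv_apply_val]
  congr 3
  ring

/-- **Schwartz–Zippel on the coins for matrix-indexed polynomials**: for a nonzero
`Q ∈ F[x_{ab} : a, b < n]`, a reading `ι` injective on `[0, 2^k)` and `n²·k ≤ N` coins, the
row-major matrix point read off the coins is a zero of `Q` with probability `≤ deg Q / 2^k`.
[cite: AroraBarakCC2009, Lemma 7.5 (Schwartz–Zippel)] [cite: BlaserIkenmeyerJindalLysikov2018, §6 (random evaluation over `𝔽_p`)] -/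
theorem uniformProb_eval_matrixPt_eq_zero_le [CommRing F] [IsDomain F] {ι : ℕ → F} {n k N : ℕ} (hN : n * n * k ≤ N)
    (hι : Set.InjOn ι (Set.Iio (2 ^ k))) {Q : MvPolynomial (Fin n × Fin n) F} (hQ : Q ≠ 0) :
    uniformProb N {z | MvPolynomial.eval (matrixPt ι k n z) Q = 0} ≤ (Q.totalDegree : ℝ) / 2 ^ k := by
  set e : Fin n × Fin n ≃ Fin (n * n) := finProdFinEquiv with he
  have hQ' : MvPolynomial.rename e Q ≠ 0 :=
    (_root_.map_ne_zero_iff _ (MvPolynomial.rename_injective _ e.injective)).2 hQ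
  have hset : {z : List Bool | MvPolynomial.eval (matrixPt ι k n z) Q = 0} =
      {z | MvPolynomial.eval (blockPt ι k (n * n) z) (MvPolynomial.rename e Q) = 0} := by
    ext z
    simp only [Set.mem_setOf_eq, MvPolynomial.eval_rename, matrixPt_eq_blockPt_comp, he]
  rw [hset]
  refine (uniformProb_eval_blockPt_eq_zero_le_of_le hN hι hQ').trans ?_
  gcongr
  exact MvPolynomial.totalDegree_rename_le _ _

/-! ### The instance `𝔽_p` -/

/-- **The cast `ℕ → ZMod p` is injective on `[0, 2^k)` when `2^k ≤ p`.**
[cite: BlaserIkenmeyerJindalLysikov2018, §6 (random evaluation over `𝔽_p`)] -/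
theorem natCast_injOn_of_two_pow_le {p k : ℕ} (hp : 2 ^ k ≤ p) :
    Set.InjOn (Nat.cast : ℕ → ZMod p) (Set.Iio (2 ^ k)) := by
  intro a ha b hb h
  have ha' : a < p := lt_of_lt_of_le ha hp
  have hb' : b < p := lt_of_lt_of_le hb hp
  have h1 := congr_arg ZMod.val h
  rwa [ZMod.val_natCast, ZMod.val_natCast, Nat.mod_eq_of_lt ha', Nat.mod_eq_of_lt hb'] at h1

/-- **Schwartz–Zippel over `𝔽_p` on the coins, matrix form**: for a prime `p` with `2^k ≤ p`, a
nonzero `Q ∈ 𝔽_p[x_{ab} : a, b < n]` vanishes at the matrix point read off `N ≥ n²k` uniform coins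
(block values cast into `𝔽_p`) with probability `≤ deg Q / 2^k`.
[cite: BlaserIkenmeyerJindalLysikov2018, §6 (random evaluation over `𝔽_p`)] [cite: AroraBarakCC2009, Lemma 7.5 (Schwartz–Zippel)] -/
theorem uniformProb_eval_matrixPt_zmod_eq_zero_le {p : ℕ} [Fact p.Prime] {n k N : ℕ} (hN : n * n * k ≤ N)
    (hp : 2 ^ k ≤ p) {Q : MvPolynomial (Fin n × Fin n) (ZMod p)} (hQ : Q ≠ 0) :
    uniformProb N {z | MvPolynomial.eval (matrixPt (Nat.cast : ℕ → ZMod p) k n z) Q = 0} ≤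
      (Q.totalDegree : ℝ) / 2 ^ k :=
  uniformProb_eval_matrixPt_eq_zero_le hN (natCast_injOn_of_two_pow_le hp) hQ

end ModularZeroTest

end Literature.Computability.Complexity

end
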